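import Literature.AlgebraicGeometry.Frobenioids.CoAngular
import Literature.AlgebraicGeometry.Frobenioids.BiratSubfunctor
import Literature.AlgebraicGeometry.Frobenioids.ModelFrobenioidFunctor
import HarnessLib

/-!
# Frobenioids I, §5: Theorem 5.1 (Divisorial Descriptions), parts (i)–(iii)

Mochizuki, *The geometry of Frobenioids I: the general theory*, Kyushu J. Math. **62** (2008)
293–400, §5 "Model Frobenioids", Theorem 5.1 (i)–(iii), kurims text pp. 96–97 (statement),
pp. 97–99 (proof) [cite: MochizukiFrdI2008, Thm. 5.1 p.96].

**Setting (p. 96).** A divisorial monoid `Φ` on a connected, totally epimorphic category `D` and a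
Frobenioid `C → F_Φ` (here: a functor `F : C ⥤ ElemFrobenioid Φ` with the hypothesis
`IsFrobenioid F` where a statement needs it) *of isotropic type*; `A, A' ∈ Ob(C)` Frobenius-trivial,
`A_D := Base(A)`; `D^isom ⊆ D` the subcategory of isomorphisms, `D^isom_D := (D^isom)_D`;
`Pic_Φ(A) := Φ^gp(A)/Φ^birat(A)` [cf. Prop. 4.4 (iii)]; `Pic_C(A)` := the set of isomorphism
classes of the categorical fiber product `C ×_D D^isom_{A_D}` (§0 p. 17).

**Contents (STATEMENTS-FIRST; one declaration per printed clause).** `GpSubfunctor Φ` (file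
`GroupSubfunctors.lean`) = a subfunctor of groups `Ψ ⊆ Φ^gp` on `D` with `Ψ.Pic X := Φ^gp(X)/Ψ(X)`,
`Ψ.picPull`; `0_D = zeroMonoid D` (`ModelFrobenioidFunctor.lean`, canonical; alias `zeroMonoidOn`): in Theorem 5.1 `Ψ` is **`Φ^birat ⊆ Φ^gp` of Prop. 4.4
(iii)** (p. 83): every statement is typed over a general PARAMETER `Ψ` and then INSTANTIATED
(`Thm51i`, `Thm51ii`, `PicPhi`) with the concrete `Φ^birat = biratSubfunctor F` of
`BiratSubfunctor.lean` (this seat, L1-lead RULING W2-4; its agreement with the abstract interface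
`PreFrobenioidData.BiratData`/`Prop44iii` of the §4 files is the merge debt
`TODO-merge abc-iut-L1-t3`). `APair F A` = the "`A`-pairs" of the proof of (i) (p. 97) with the two
printed assignments `APair.cls ∈ Φ^gp(A)`, `APair.toIsomOver ∈ Ob(C ×_D D^isom_{A_D})`;
`IsomOver`/`PicC` = objects `(C, ζ : C_D ⥲ A₀)` and `Pic_C(A)`. (i): `Thm51i_bijection`,
`Thm51i_frobenius` (named statements; proof pp. 97–99, HARD). (ii): `Thm51ii_exists_iff` (named
statement); `thm51ii_unique` — the "Moreover" PROVED in its printed `F_Φ`-form (immediate: a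
morphism of `F_Φ` is the triple `(Base, Div, deg_Fr)`; the `C^un-tr`-form is equivalent by Prop. 3.3
(ii)/(iv), abc-iut-L1-t3's `Prop33ii`/`Prop33iv`). (iii): `FrTr F` = `C^Fr-tr` with structure functor
`frTrFunctor : C^Fr-tr → F_{0_D}` (READING below); `Thm51iii_isFrobenioid/isotropic/baseTrivial/
autAmple` (named statements, HARD), `frTr_isGroupLikeObj` (the "group-like" clause, PROVED — formal
for `0_D`), the "In particular" clauses `Thm51iii_iso_of_baseIso`,
`Thm51iii_frobeniusTrivial_isAutAmple`. (iv) is typed in `DivisorialDescriptionsSections.lean`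
over the §2 Def. 2.7 declarations (base-sections, Frobenius-sections).

**READING recorded for the referee (iii).** The text calls `C^Fr-tr` "a Frobenioid of isotropic,
group-like, base-trivial, and `Aut`-ample type" without naming its functor to an elementary
Frobenioid. All morphisms of `C^Fr-tr` are isometric, so the restriction of `C → F_Φ` has zero
divisors `0` throughout and cannot satisfy Def. 1.3 (iii)(d) unless `Φ = 0`; the clause "group-like
type" (`Φ(A) = 0` for all objects, Def. 1.2 (iv)) shows the intended structure is the composite
`C^Fr-tr → F_Φ → F_{0_D}` with the zero monoid `0_D` (the device of `C^birat → F_{0_D}`, Prop. 4.4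
(i)(ii) p. 83). We type (iii) for this functor; no statement is strengthened.
**Dictionary.** Additive monoids are multiplicative `CommMonoid`s as elsewhere in this directory:
`Div(ψ) − Div(φ) ↦ Div ψ / Div φ` in `Φ^gp = Algebra.GrothendieckGroup`, `d · γ ↦ γ ^ d`;
composition is diagrammatic, so `Base(φ) ∘ Base(ψ)⁻¹ ↦ inv (Base ψ) ≫ Base φ`.
-/

namespace Literature.AlgebraicGeometry.Frobenioids

open CategoryTheory Opposite

universe w v v' u u'

namespace PreFrobenioid

variable {D : Type u} [Category.{v} D] {Φ : Dᵒᵖ ⥤ CommMonCat.{w}}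
  {C : Type u'} [Category.{v'} C] (F : C ⥤ ElemFrobenioid Φ)

/-! ### `Pic_C(A)`: isomorphism classes of `C ×_D D^isom_{A_D}` -/

/-- An object of `C ×_D D^isom_{A₀}` (p. 96), rendered as a pair `(C, ζ : C_D ⥲ A₀)`: an object
`C` of `C` together with an isomorphism of `D` from its base `C_D := Base(C)` to `A₀`. (The §0
categorical fiber product `CFP` has objects `(C, (B, ζ_B : B ⥲ A₀), α : C_D ⥲ B)`; composing
`α` with `ζ_B` identifies its isomorphism classes with those of these pairs — the text itself writes
objects as pairs `(C, Base(φ) ∘ Base(ψ)⁻¹)`.) [cite: MochizukiFrdI2008, Thm. 5.1 p.96] -/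
structure IsomOver (A₀ : D) where
  /-- the object `C ∈ Ob(C)` -/
  obj : C
  /-- the isomorphism `ζ : C_D ⥲ A₀` of `D` -/
  iso : baseObj F obj ≅ A₀

namespace IsomOver

variable {F} {A₀ : D}

/-- Isomorphism in `C ×_D D^isom_{A₀}`: `(C, ζ) ≅ (C', ζ')` iff there is an isomorphism
`κ : C ⥲ C'` of `C` with `ζ' ∘ Base(κ) = ζ` (a morphism of the fiber product category is a pair of
morphisms compatible with the structure isomorphisms, §0 p. 17). [cite: MochizukiFrdI2008, Thm. 5.1 p.96] -/
def IsIsomorphic (X Y : IsomOver F A₀) : Prop :=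
  ∃ κ : X.obj ≅ Y.obj, Base F κ.hom ≫ Y.iso.hom = X.iso.hom

/-- Isomorphism in `C ×_D D^isom_{A₀}` is reflexive. [cite: MochizukiFrdI2008, Thm. 5.1 p.96] -/
theorem IsIsomorphic.refl (X : IsomOver F A₀) : IsIsomorphic X X :=
  ⟨Iso.refl _, by rw [Iso.refl_hom, base_id, Category.id_comp]⟩

/-- Isomorphism in `C ×_D D^isom_{A₀}` is symmetric. [cite: MochizukiFrdI2008, Thm. 5.1 p.96] -/
theorem IsIsomorphic.symm {X Y : IsomOver F A₀} (h : IsIsomorphic X Y) : IsIsomorphic Y X := by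
  obtain ⟨κ, hκ⟩ := h
  refine ⟨κ.symm, ?_⟩
  have h1 : Base F κ.inv ≫ Base F κ.hom = 𝟙 _ := by rw [← base_comp, Iso.inv_hom_id, base_id]
  calc Base F κ.symm.hom ≫ X.iso.hom = Base F κ.inv ≫ Base F κ.hom ≫ Y.iso.hom := by
        rw [hκ]; rfl
    _ = Y.iso.hom := by rw [← Category.assoc, h1, Category.id_comp]

/-- Isomorphism in `C ×_D D^isom_{A₀}` is transitive. [cite: MochizukiFrdI2008, Thm. 5.1 p.96] -/
theorem IsIsomorphic.trans {X Y Z : IsomOver F A₀} (h : IsIsomorphic X Y) (h' : IsIsomorphic Y Z) :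
    IsIsomorphic X Z := by
  obtain ⟨κ, hκ⟩ := h
  obtain ⟨κ', hκ'⟩ := h'
  refine ⟨κ ≪≫ κ', ?_⟩
  rw [Iso.trans_hom, base_comp, Category.assoc, hκ', hκ]

variable (F A₀) in
/-- The isomorphism relation of `C ×_D D^isom_{A₀}` as a setoid. [cite: MochizukiFrdI2008, Thm. 5.1 p.96] -/
instance setoid : Setoid (IsomOver F A₀) where
  r := IsIsomorphic
  iseqv := ⟨IsIsomorphic.refl, IsIsomorphic.symm, IsIsomorphic.trans⟩

/-- For a base-isomorphism `κ : C → C'` (e.g. a morphism of Frobenius type) the object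
`(C', ζ ∘ Base(κ)⁻¹)` of `C ×_D D^isom_{A_D}` (Thm. 5.1 (i), "Moreover", p. 96).
[cite: MochizukiFrdI2008, Thm. 5.1 (i) p.96] -/
noncomputable def pushforward (X : IsomOver F A₀) {C' : C} (κ : X.obj ⟶ C') (hκ : IsBaseIso F κ) :
    IsomOver F A₀ :=
  haveI : IsIso (Base F κ) := hκ
  ⟨C', (asIso (Base F κ)).symm ≪≫ X.iso⟩

end IsomOver

/-- `Pic_C(A)` for `A₀ = A_D`: "the set of isomorphism classes of `C ×_D D^isom_{A_D}`" (p. 96).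
[cite: MochizukiFrdI2008, Thm. 5.1 p.96] -/
def PicC (A₀ : D) : Type (max u' v) := Quotient (IsomOver.setoid F A₀)

/-! ### `A`-pairs and the two assignments of Theorem 5.1 (i) -/

/-- An *`A`-pair* (proof of Thm. 5.1 (i), p. 97 ll. 21–23): an ordered pair of pre-steps
`(φ : B → A, ψ : B → C)` — "the first pre-step has codomain `A`, and the second pre-step has the
same domain as the first". [cite: MochizukiFrdI2008, Thm. 5.1 (i) p.97] -/
structure APair (A : C) where
  /-- the common domain `B` -/
  src : C
  /-- the codomain `C` of the second pre-step -/
  tgt : C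
  /-- `φ : B → A` -/
  fst : src ⟶ A
  /-- `ψ : B → C` -/
  snd : src ⟶ tgt
  /-- `φ` is a pre-step -/
  isPreStep_fst : IsPreStep F fst
  /-- `ψ` is a pre-step -/
  isPreStep_snd : IsPreStep F snd

namespace APair

variable {F} {A : C} (p : APair F A)

/-- The object `(C, Base(φ) ∘ Base(ψ)⁻¹) ∈ Ob(C ×_D D^isom_{A_D})` assigned to the `A`-pair
`(φ : B → A, ψ : B → C)` (Thm. 5.1 (i), p. 96). [cite: MochizukiFrdI2008, Thm. 5.1 (i) p.96] -/
noncomputable def toIsomOver : IsomOver F (baseObj F A) :=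
  haveI : IsIso (Base F p.fst) := p.isPreStep_fst.2
  haveI : IsIso (Base F p.snd) := p.isPreStep_snd.2
  ⟨p.tgt, (asIso (Base F p.snd)).symm ≪≫ asIso (Base F p.fst)⟩

/-- The element `Φ(φ)⁻¹(Div(ψ) − Div(φ)) ∈ Φ^gp(A)` assigned to the `A`-pair `(φ, ψ)` (Thm. 5.1 (i),
p. 96); `Φ(φ)⁻¹ = (Base(φ)⁻¹)^*` since `φ` is a base-isomorphism; multiplicatively
`(Base φ)⁻¹^*(Div ψ) / (Base φ)⁻¹^*(Div φ)`. [cite: MochizukiFrdI2008, Thm. 5.1 (i) p.96] -/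
noncomputable def cls : Algebra.GrothendieckGroup (Φ.obj (op (baseObj F A))) :=
  haveI : IsIso (Base F p.fst) := p.isPreStep_fst.2
  Algebra.GrothendieckGroup.of (pull Φ (inv (Base F p.fst)) (Div F p.snd)) /
    Algebra.GrothendieckGroup.of (pull Φ (inv (Base F p.fst)) (Div F p.fst))

end APair

/-! ### Theorem 5.1 (i) -/

section ThmI

variable (Ψ : GpSubfunctor Φ)

/-- **Theorem 5.1 (i)** (named statement; proof pp. 97–99, HARD): for `C` a Frobenioid of isotropic
type and `A` Frobenius-trivial, "the assignment that maps a pair of pre-steps `(φ : B → A, ψ : B → C)`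
to the object `(C, Base(φ) ∘ Base(ψ)⁻¹) ∈ Ob(C ×_D D^isom_{A_D})` on the one hand and to the element
`Φ(φ)⁻¹(Div(ψ) − Div(φ)) ∈ Φ^gp(A)` on the other hand determines a bijection `Pic_Φ(A) ⥲ Pic_C(A)`"
— rendered as: two `A`-pairs have the same class in `Pic_Φ(A)` iff they have the same class in
`Pic_C(A)`, and both assignments reach every class. GENERAL FORM over the parameter `Ψ` (W2-8 (5):
a schema while `Ψ` is free); the closed statement of the text is the instantiation `Thm51i`
(`Ψ := biratSubfunctor F`) below. [cite: MochizukiFrdI2008, Thm. 5.1 (i) p.96] -/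
def Thm51i_bijection (A : C) : Prop :=
  IsFrobenioid F → IsOfIsotropicType F → IsFrobeniusTrivial F A →
    (∀ p q : APair F A,
        (QuotientGroup.mk p.cls : Ψ.Pic (baseObj F A)) = QuotientGroup.mk q.cls ↔
          (⟦p.toIsomOver⟧ : PicC F (baseObj F A)) = ⟦q.toIsomOver⟧) ∧
      (∀ γ : Ψ.Pic (baseObj F A), ∃ p : APair F A, QuotientGroup.mk p.cls = γ) ∧
      (∀ c : PicC F (baseObj F A), ∃ p : APair F A, ⟦p.toIsomOver⟧ = c)

/-- **Theorem 5.1 (i)**, "Moreover" (named statement, HARD): "if `(C, ζ : C_D ⥲ A_D)` corresponds,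
via this bijection, to an element `γ ∈ Pic_Φ(A)`, and `κ : C → C'` is a morphism of Frobenius type,
then `(C', ζ ∘ Base(κ)⁻¹)` corresponds to the element `deg_Fr(κ) · γ ∈ Pic_Φ(A)`" — rendered on
representatives: for `A`-pairs `p`, `p'` representing `(C, ζ)` and `(C', ζ ∘ Base(κ)⁻¹)` in
`Pic_C(A)`, the class of `p'` in `Pic_Φ(A)` is the `deg_Fr(κ)`-th power (additively: multiple) of
that of `p`. GENERAL FORM over `Ψ`; closed instantiation = `Thm51i`. [cite: MochizukiFrdI2008, Thm. 5.1 (i) p.96] -/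
def Thm51i_frobenius (A : C) : Prop :=
  IsFrobenioid F → IsOfIsotropicType F → IsFrobeniusTrivial F A →
    ∀ (X : IsomOver F (baseObj F A)) {C' : C} (κ : X.obj ⟶ C') (hκ : IsFrobeniusType F κ)
      (p p' : APair F A),
      (⟦p.toIsomOver⟧ : PicC F (baseObj F A)) = ⟦X⟧ →
      (⟦p'.toIsomOver⟧ : PicC F (baseObj F A)) = ⟦X.pushforward κ hκ.2⟧ →
        (QuotientGroup.mk p'.cls : Ψ.Pic (baseObj F A)) =
          QuotientGroup.mk p.cls ^ (degFr F κ : ℕ)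

end ThmI

/-! ### Theorem 5.1 (ii) -/

section ThmII

variable (Ψ : GpSubfunctor Φ)

/-- The data fixed in Theorem 5.1 (ii) for a candidate morphism `φ : B → B'`: Frobenius degree `d`,
projection `Base(φ) = (λ')⁻¹ ∘ θ ∘ λ` and zero divisor `Div(φ) = z` (p. 97 ll. 1–3).
[cite: MochizukiFrdI2008, Thm. 5.1 (ii) p.97] -/
def HasThm51iiData {A₀ A₀' : D} (X : IsomOver F A₀) (X' : IsomOver F A₀') (d : ℕ+) (θ : A₀ ⟶ A₀')
    (z : Φ.obj (op (baseObj F X.obj))) (φ : X.obj ⟶ X'.obj) : Prop :=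
  degFr F φ = d ∧ Base F φ = X.iso.hom ≫ θ ≫ X'.iso.inv ∧ Div F φ = z

/-- **Theorem 5.1 (ii)** (named statement; "follows formally from (i)", HARD with (i)): for
Frobenius-trivial `A, A'` and objects `(B, λ : B_D ⥲ A_D) ∈ Ob(C ×_D D^isom_{A_D})`,
`(B', λ' : B'_D ⥲ A'_D) ∈ Ob(C ×_D D^isom_{A'_D})`, "there exists a morphism `φ : B → B'` in `C` of
Frobenius degree `d` such that `Base(φ) = (λ')⁻¹ ∘ θ ∘ λ`, where `θ : A_D → A'_D` is a morphism of
`D`, and `Div(φ) = z ∈ Φ(B)` if and only if the classes `β ∈ Pic_Φ(A)`, `β' ∈ Pic_Φ(A')` determined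
by `B`, `B'`, respectively, via the bijection of (i) satisfy `d · β + z|_{A_D} = (Φ(θ))(β')` in
`Pic_Φ(A)` [where … `z|_{A_D}` (is) the image of `Φ(λ)⁻¹(z) ∈ Φ(A)` in `Pic_Φ(A)`]" — the classes
`β`, `β'` are taken on `A`-pair, resp. `A'`-pair, representatives `p`, `p'` of `(B, λ)`, `(B', λ')`; `Φ(λ)⁻¹ =
(λ⁻¹)^*`. GENERAL FORM over `Ψ`; closed instantiation = `Thm51ii`. [cite: MochizukiFrdI2008, Thm. 5.1 (ii) p.96] -/
def Thm51ii_exists_iff (A A' : C) : Prop :=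
  IsFrobenioid F → IsOfIsotropicType F → IsFrobeniusTrivial F A → IsFrobeniusTrivial F A' →
    ∀ (X : IsomOver F (baseObj F A)) (X' : IsomOver F (baseObj F A'))
      (p : APair F A) (p' : APair F A'),
      (⟦p.toIsomOver⟧ : PicC F (baseObj F A)) = ⟦X⟧ →
      (⟦p'.toIsomOver⟧ : PicC F (baseObj F A')) = ⟦X'⟧ →
      ∀ (d : ℕ+) (θ : baseObj F A ⟶ baseObj F A') (z : Φ.obj (op (baseObj F X.obj))),
        (∃ φ : X.obj ⟶ X'.obj, HasThm51iiData F X X' d θ z φ) ↔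
          (QuotientGroup.mk p.cls : Ψ.Pic (baseObj F A)) ^ (d : ℕ) *
              QuotientGroup.mk (Algebra.GrothendieckGroup.of (pull Φ X.iso.inv z)) =
            Ψ.picPull θ (QuotientGroup.mk p'.cls)

/-- **Theorem 5.1 (ii)**, "Moreover" (PROVED in the printed `F_Φ`-form): "if such a morphism exists,
then its unit-equivalence class [i.e., its image in `C^un-tr`, or, equivalently, `F_Φ` — cf.
Proposition 3.3, (iv)] is unique": two morphisms `B → B'` with the prescribed Frobenius degree,
projection to `D` and zero divisor have the same image in `F_Φ`. (Immediate, since a morphism of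
`F_Φ` IS the triple `(Base, Div, deg_Fr)`; the equivalence with the `C^un-tr`-form is Prop. 3.3
(ii)/(iv).) [cite: MochizukiFrdI2008, Thm. 5.1 (ii) p.97] -/
theorem thm51ii_unique {A₀ A₀' : D} (X : IsomOver F A₀) (X' : IsomOver F A₀') (d : ℕ+)
    (θ : A₀ ⟶ A₀') (z : Φ.obj (op (baseObj F X.obj))) {φ₁ φ₂ : X.obj ⟶ X'.obj}
    (h₁ : HasThm51iiData F X X' d θ z φ₁) (h₂ : HasThm51iiData F X X' d θ z φ₂) :
    F.map φ₁ = F.map φ₂ := by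
  obtain ⟨hd₁, hb₁, hz₁⟩ := h₁
  obtain ⟨hd₂, hb₂, hz₂⟩ := h₂
  apply ElemFrobenioid.Hom.ext
  · exact hb₁.trans hb₂.symm
  · exact hz₁.trans hz₂.symm
  · exact hd₁.trans hd₂.symm

end ThmII

/-! ### Theorem 5.1 (iii): the subcategory `C^Fr-tr` -/

/-- `C^Fr-tr ⊆ C`: "the subcategory determined by the Frobenius-trivial objects and isometric
morphisms" (Thm. 5.1 (iii), p. 97) — its type of objects. [cite: MochizukiFrdI2008, Thm. 5.1 (iii) p.97] -/
def FrTr : Type u' := {A : C // IsFrobeniusTrivial F A}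

namespace FrTr

variable {F}

/-- `C^Fr-tr` is a category: morphisms are the isometric morphisms of `C` (identities are isometric,
`Div(id) = 0`; composites of isometries are isometric, Remark 1.1.1).
[cite: MochizukiFrdI2008, Thm. 5.1 (iii) p.97] -/
instance instCategory : Category.{v'} (FrTr F) where
  Hom A B := {φ : A.1 ⟶ B.1 // IsIsometry F φ}
  id A := ⟨𝟙 A.1, div_id F A.1⟩
  comp φ ψ := ⟨φ.1 ≫ ψ.1, IsIsometry.comp F φ.2 ψ.2⟩
  id_comp _ := Subtype.ext (Category.id_comp _)
  comp_id _ := Subtype.ext (Category.comp_id _)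
  assoc _ _ _ := Subtype.ext (Category.assoc _ _ _)

/-- Extensionality for morphisms of `C^Fr-tr`. [cite: MochizukiFrdI2008, Thm. 5.1 (iii) p.97] -/
@[ext] theorem hom_ext {A B : FrTr F} {φ ψ : A ⟶ B} (h : φ.1 = ψ.1) : φ = ψ := Subtype.ext h

variable (F) in
/-- The inclusion `C^Fr-tr ⊆ C`. [cite: MochizukiFrdI2008, Thm. 5.1 (iii) p.97] -/
def ι : FrTr F ⥤ C where
  obj A := A.1
  map φ := φ.1

end FrTr

/-- ALIAS; canonical name = `zeroMonoid` (L1-lead RULING C6): the zero monoid `0_D` of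
`GroupSubfunctors.lean` (`zeroMonoidOn`) is the `zeroMonoid D` of `ModelFrobenioidFunctor.lean`
(seat abc-iut-L1-t2, accepted first); the two are definitionally equal.
[cite: MochizukiFrdI2008, Prop. 4.4 (i) p.83] -/
theorem zeroMonoidOn_eq_zeroMonoid : zeroMonoidOn.{w} D = zeroMonoid D := rfl

/-- The values of `0_D = zeroMonoid D` have exactly one element. [cite: MochizukiFrdI2008, Prop. 4.4 (i) p.83] -/
instance subsingleton_zeroMonoid_obj (X : Dᵒᵖ) :
    Subsingleton ((zeroMonoid D : Dᵒᵖ ⥤ CommMonCat.{w}).obj X) :=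
  inferInstanceAs (Subsingleton PUnit)

/-- The structure functor `C^Fr-tr → F_{0_D}`, `A ↦ A_D`, `φ ↦ (Base(φ), 0, deg_Fr(φ))`: the
composite `C^Fr-tr ⊆ C → F_Φ → F_{0_D}` (see the module docstring, READING (iii)); `0_D` is the
canonical `zeroMonoid D` (RULING C6). [cite: MochizukiFrdI2008, Thm. 5.1 (iii) p.97] -/
def frTrFunctor : FrTr F ⥤ ElemFrobenioid (zeroMonoid D : Dᵒᵖ ⥤ CommMonCat.{w}) where
  obj A := ElemFrobenioid.of _ (baseObj F A.1)
  map φ := ElemFrobenioid.homMk (Base F φ.1) 1 (degFr F φ.1)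
  map_id A := by
    apply ElemFrobenioid.Hom.ext
    · exact base_id F A.1
    · exact Subsingleton.elim _ _
    · exact degFr_id F A.1
  map_comp φ ψ := by
    apply ElemFrobenioid.Hom.ext
    · exact base_comp F φ.1 ψ.1
    · exact Subsingleton.elim _ _
    · exact degFr_comp F φ.1 ψ.1

/-- **Theorem 5.1 (iii)**, "group-like type" clause (PROVED — formal for the zero monoid `0_D`):
every object of `C^Fr-tr → F_{0_D}` is group-like. [cite: MochizukiFrdI2008, Thm. 5.1 (iii) p.97] -/
theorem frTr_isGroupLikeObj : IsOfType (IsGroupLikeObj (frTrFunctor F)) :=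
  fun _ _ => Subsingleton.elim _ _

/-- **Theorem 5.1 (iii)** (named statement, HARD — "is a Frobenioid" verification, proof p. 99):
for `C` a Frobenioid of isotropic type, "`C^Fr-tr` … is a Frobenioid" (w.r.t. `C^Fr-tr → F_{0_D}`).
[cite: MochizukiFrdI2008, Thm. 5.1 (iii) p.97] -/
def Thm51iii_isFrobenioid : Prop :=
  IsFrobenioid F → IsOfIsotropicType F → IsFrobenioid (frTrFunctor F)

/-- **Theorem 5.1 (iii)** (named statement): `C^Fr-tr` is "of isotropic … type".
[cite: MochizukiFrdI2008, Thm. 5.1 (iii) p.97] -/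
def Thm51iii_isotropic : Prop :=
  IsFrobenioid F → IsOfIsotropicType F → IsOfIsotropicType (frTrFunctor F)

/-- **Theorem 5.1 (iii)** (named statement): `C^Fr-tr` is "of … base-trivial … type".
[cite: MochizukiFrdI2008, Thm. 5.1 (iii) p.97] -/
def Thm51iii_baseTrivial : Prop :=
  IsFrobenioid F → IsOfIsotropicType F → IsOfType (IsBaseTrivial (frTrFunctor F))

/-- **Theorem 5.1 (iii)** (named statement): `C^Fr-tr` is "of … `Aut`-ample type".
[cite: MochizukiFrdI2008, Thm. 5.1 (iii) p.97] -/
def Thm51iii_autAmple : Prop :=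
  IsFrobenioid F → IsOfIsotropicType F → IsOfType (IsAutAmple (frTrFunctor F))

/-- **Theorem 5.1 (iii)**, "In particular" (named statement): "the isomorphism class of a
Frobenius-trivial object of `C` is completely determined by the isomorphism class of its projection
to `D`" — base-isomorphic Frobenius-trivial objects are isomorphic (proof p. 99 ll. 40–43).
[cite: MochizukiFrdI2008, Thm. 5.1 (iii) p.97] -/
def Thm51iii_iso_of_baseIso : Prop :=
  IsFrobenioid F → IsOfIsotropicType F → ∀ A A' : C, IsFrobeniusTrivial F A →
    IsFrobeniusTrivial F A' → BaseIsomorphic F A A' → Nonempty (A ≅ A')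

/-- **Theorem 5.1 (iii)**, "In particular" (named statement): "all Frobenius-trivial objects of `C`
are `Aut`-ample". [cite: MochizukiFrdI2008, Thm. 5.1 (iii) p.97] -/
def Thm51iii_frobeniusTrivial_isAutAmple : Prop :=
  IsFrobenioid F → IsOfIsotropicType F → ∀ A : C, IsFrobeniusTrivial F A → IsAutAmple F A

/-! ### Instantiation `Ψ := Φ^birat` (the statements of the text) -/

/-- `Pic_Φ(A) := Φ^gp(A)/Φ^birat(A)` (Thm. 5.1, p. 96) with the concrete `Φ^birat` of
`BiratSubfunctor.lean`. [cite: MochizukiFrdI2008, Thm. 5.1 p.96] -/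
abbrev PicPhi (A : C) : Type w := (biratSubfunctor F).Pic (baseObj F A)

/-- **Theorem 5.1 (i)** as printed (`Ψ = Φ^birat`): the bijection `Pic_Φ(A) ⥲ Pic_C(A)` and its
compatibility with morphisms of Frobenius type (named statement, HARD).
[cite: MochizukiFrdI2008, Thm. 5.1 (i) p.96] -/
abbrev Thm51i (A : C) : Prop :=
  Thm51i_bijection F (biratSubfunctor F) A ∧ Thm51i_frobenius F (biratSubfunctor F) A

/-- **Theorem 5.1 (ii)** as printed (`Ψ = Φ^birat`): the existence criterion
`d · β + z|_{A_D} = (Φ(θ))(β')` in `Pic_Φ(A)` (named statement; the "Moreover" is `thm51ii_unique`).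
[cite: MochizukiFrdI2008, Thm. 5.1 (ii) p.96] -/
abbrev Thm51ii (A A' : C) : Prop := Thm51ii_exists_iff F (biratSubfunctor F) A A'

end PreFrobenioid

end Literature.AlgebraicGeometry.Frobenioids
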